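import Summits.Parity.GeneralizedHardyLittlewood.Theorems.PrimeLevelFamEdgeMomentsBeyondDiagonalLayersBlockTaylor
import HarnessLib

/-!
# Route `PrimeLevelFamEdge`, crux K_A `MomentsBeyondDiagonal` (stmt-Parity-20007), line «petersson_layers» v4:
# the HIGHER TAYLOR ORDERS `k ≥ 1` of `stub_farP`'s separated forms are trivially small — `stub_farP` ⟸ the `k = 0` forms

Fifth layer of the top-down assembly (after `…LayersFormReduction.subFar_rhoP_of_form_bound`).  With the mollifier
normalisation `|x_m| ≤ B m^{−1/2}` (`KMV2000.abs_mollifierCoeff_le`) and the weight bound `‖(N₁N₂)^{−1/2}W_{ij}‖√(N₁N₂) ≪ L`,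
the `k`-th separated form of a `(d₁,d₂)`-block satisfies the TRIVIAL bound (`|S(a,b;qr)| ≤ qr`, no cancellation at all)
`‖Form_k(d₁,d₂;r)‖ ≤ qr · B²K L(1+2log q) · (M²Y)^{k+1}/(d₁d₂)^{2k+2}`, so `Σ_{d₁,d₂}‖Form_k‖ ≤ 4qr·B²KL(1+2log q)(M²Y)^{k+1}`;
against the target `q̂^{−δ}(qr)^{2k+2}/r` this wins by `[(qr)²/(M²Y)]^{k}·(qr)/(M²Y r)·… = q̂^{(2.2−2λ−η)k − (2+2λ+η) − …}`, i.e.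
for every `k ≥ 1` on a short window (`λ = Δ'−1 ≤ 1/100`, `η ≤ 1/100`; exponent check `4.03(k+1)+0.02 ≤ 6.2k+2`).
Only the leading Taylor order `k = 0` (the `J₁(x) ≈ x/2` term) needs cancellation in the Kloosterman sums:
* §1 `ℓ¹` sizes of the two sides of `Form_k`; §2 the trivial bound for one block and for the `(d₁,d₂)`-sum; §3 the scales;
* §4 **`subFar_rhoP_of_form_bound_zero`**: `SubFar rhoP` ⟸ on a window `(1, Δ₀] ⊆ (1, 101/100]`, for every admissible `P`
  and `Δ'`: ONE `δ > 0`, ONE `η ∈ (0, 1/100]` and, per order `(i,j)`, constants `A, q₀` with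
  `Σ_{d₁,d₂ ≤ M} ‖Form_{ij0}(d₁,d₂;r)‖ ≤ A · q̂^{−δ} · (qr)² · r⁻¹` on the band.
Proof only (def-free helper); K_A NOT proved; nothing about Landau–Siegel zeros.
-/

noncomputable section

open scoped Real Nat
open Complex Finset Polynomial MeasureTheory
open Literature.NumberTheory.LFunctions

namespace Summit.Parity.GeneralizedHardyLittlewood.Theorems.MomentsBeyondDiagonal.Layers

open Summit.Parity.GeneralizedHardyLittlewood.Theorems.PrimeLevelFamEdgeIdeaDeltas.PeterssonLayers
open Summit.Parity.GeneralizedHardyLittlewood.Theorems.MomentsBeyondDiagonal.TwoOrderAFE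
  (one_add_two_log_le one_add_log_pow_le_rpow)

/-! ## §1. The `ℓ¹` sizes of the two sides of a separated form -/

/-- `√m^{2k+1} = m^k · √m` (`m ≥ 0`). [folklore] -/
theorem sqrt_pow_two_mul_add_one {m : ℝ} (hm : 0 ≤ m) (k : ℕ) : Real.sqrt m ^ (2 * k + 1) = m ^ k * Real.sqrt m := by
  rw [pow_succ, pow_mul, Real.sq_sqrt hm]

/-- **Mollifier side**: `Σ_{m₁≤M/d₁, m₂≤M/d₂} |x_{d₁m₁}x_{d₂m₂}|(√m₁√m₂)^{2k+1} ≤ B² (M²/(d₁d₂))^{k+1}` (`|x_{dm}|√m ≤ B`, `m ≤ M/d`).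
[folklore] -/
theorem sum_mollifier_side_le {q : ℕ} [NeZero q] (h64 : 64 ≤ q) {P : ℝ[X]} {B : ℝ}
    (hB : ∀ t ∈ Set.Icc (0 : ℝ) 1, |P.eval t| ≤ B) {Δ' : ℝ} (hΔ' : 0 < Δ') (k : ℕ) {d₁ d₂ : ℕ}
    (hd₁ : d₁ ∈ Icc 1 ⌊KMV2000.qhat q ^ Δ'⌋₊) (hd₂ : d₂ ∈ Icc 1 ⌊KMV2000.qhat q ^ Δ'⌋₊) :
    ∑ m₁ ∈ Icc 1 (⌊KMV2000.qhat q ^ Δ'⌋₊ / d₁), ∑ m₂ ∈ Icc 1 (⌊KMV2000.qhat q ^ Δ'⌋₊ / d₂),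
      ‖(KMV2000.mollifierCoeff P (KMV2000.qhat q ^ Δ') (d₁ * m₁) : ℂ) *
          (KMV2000.mollifierCoeff P (KMV2000.qhat q ^ Δ') (d₂ * m₂) : ℂ) *
          ((Real.sqrt m₁ ^ (2 * k + 1) * Real.sqrt m₂ ^ (2 * k + 1) : ℝ) : ℂ)‖ ≤
      B ^ 2 * ((((⌊KMV2000.qhat q ^ Δ'⌋₊ : ℕ) : ℝ)) ^ 2 / ((d₁ : ℝ) * d₂)) ^ (k + 1) := by
  have hqh1 : 1 < KMV2000.qhat q := one_lt_qhat h64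
  have hM1 : 1 < KMV2000.qhat q ^ Δ' := Real.one_lt_rpow hqh1 hΔ'
  have hB0 : 0 ≤ B := le_trans (abs_nonneg _) (hB 0 (by simp))
  set Mf : ℕ := ⌊KMV2000.qhat q ^ Δ'⌋₊ with hMf
  have hd₁1 : 1 ≤ d₁ := (mem_Icc.mp hd₁).1
  have hd₂1 : 1 ≤ d₂ := (mem_Icc.mp hd₂).1
  have hd₁0 : (0 : ℝ) < d₁ := by exact_mod_cast hd₁1
  have hd₂0 : (0 : ℝ) < d₂ := by exact_mod_cast hd₂1
  -- one factor: `|x_{dm}| √m^{2k+1} ≤ B X^k` for `m ≤ X = M/d`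
  have hone : ∀ {d X m : ℕ}, 1 ≤ d → d * m ∈ Icc 1 Mf → m ∈ Icc 1 X →
      ‖(KMV2000.mollifierCoeff P (KMV2000.qhat q ^ Δ') (d * m) : ℂ)‖ * Real.sqrt m ^ (2 * k + 1) ≤ B * (X : ℝ) ^ k := by
    intro d X m hd hdm hm
    have hm1 : 1 ≤ m := (mem_Icc.mp hm).1
    have hmX : (m : ℝ) ≤ X := by exact_mod_cast (mem_Icc.mp hm).2
    have hx := norm_mollifierCoeff_le hB hM1 hdm
    have hy : ((d * m : ℕ) : ℝ) ^ (-(1 / 2 : ℝ)) * Real.sqrt m ≤ 1 := rpow_neg_half_mul_sqrt_le_one hd hm1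
    rw [sqrt_pow_two_mul_add_one (Nat.cast_nonneg m)]
    calc ‖(KMV2000.mollifierCoeff P (KMV2000.qhat q ^ Δ') (d * m) : ℂ)‖ * ((m : ℝ) ^ k * Real.sqrt m)
        ≤ B * ((d * m : ℕ) : ℝ) ^ (-(1 / 2 : ℝ)) * ((m : ℝ) ^ k * Real.sqrt m) :=
          mul_le_mul_of_nonneg_right hx (by positivity)
      _ = B * (m : ℝ) ^ k * (((d * m : ℕ) : ℝ) ^ (-(1 / 2 : ℝ)) * Real.sqrt m) := by ring
      _ ≤ B * (X : ℝ) ^ k * 1 :=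
          mul_le_mul (mul_le_mul_of_nonneg_left (pow_le_pow_left₀ (Nat.cast_nonneg _) hmX k) hB0) hy
            (by positivity) (by positivity)
      _ = B * (X : ℝ) ^ k := mul_one _
  -- termwise
  have hterm : ∀ m₁ ∈ Icc 1 (Mf / d₁), ∀ m₂ ∈ Icc 1 (Mf / d₂),
      ‖(KMV2000.mollifierCoeff P (KMV2000.qhat q ^ Δ') (d₁ * m₁) : ℂ) *
          (KMV2000.mollifierCoeff P (KMV2000.qhat q ^ Δ') (d₂ * m₂) : ℂ) *
          ((Real.sqrt m₁ ^ (2 * k + 1) * Real.sqrt m₂ ^ (2 * k + 1) : ℝ) : ℂ)‖ ≤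
        (B * ((Mf / d₁ : ℕ) : ℝ) ^ k) * (B * ((Mf / d₂ : ℕ) : ℝ) ^ k) := by
    intro m₁ hm₁ m₂ hm₂
    have h₁ := hone hd₁1 (mul_mem_Icc_of_mem_div hd₁1 hm₁) hm₁
    have h₂ := hone hd₂1 (mul_mem_Icc_of_mem_div hd₂1 hm₂) hm₂
    have hs : ‖((Real.sqrt m₁ ^ (2 * k + 1) * Real.sqrt m₂ ^ (2 * k + 1) : ℝ) : ℂ)‖ =
        Real.sqrt m₁ ^ (2 * k + 1) * Real.sqrt m₂ ^ (2 * k + 1) := by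
      rw [Complex.norm_real, Real.norm_eq_abs,
        abs_of_nonneg (by positivity : (0 : ℝ) ≤ Real.sqrt m₁ ^ (2 * k + 1) * Real.sqrt m₂ ^ (2 * k + 1))]
    rw [norm_mul, norm_mul, hs]
    calc _ = (‖(KMV2000.mollifierCoeff P (KMV2000.qhat q ^ Δ') (d₁ * m₁) : ℂ)‖ * Real.sqrt m₁ ^ (2 * k + 1)) *
          (‖(KMV2000.mollifierCoeff P (KMV2000.qhat q ^ Δ') (d₂ * m₂) : ℂ)‖ * Real.sqrt m₂ ^ (2 * k + 1)) := by ring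
      _ ≤ _ := mul_le_mul h₁ h₂ (by positivity) (by positivity)
  -- sum of the constant, and `X₁ X₂ ≤ M²/(d₁d₂)`
  have hX₁ : ((Mf / d₁ : ℕ) : ℝ) ≤ (Mf : ℝ) / d₁ := Nat.cast_div_le
  have hX₂ : ((Mf / d₂ : ℕ) : ℝ) ≤ (Mf : ℝ) / d₂ := Nat.cast_div_le
  calc _ ≤ ∑ _m₁ ∈ Icc 1 (Mf / d₁), ∑ _m₂ ∈ Icc 1 (Mf / d₂),
          (B * ((Mf / d₁ : ℕ) : ℝ) ^ k) * (B * ((Mf / d₂ : ℕ) : ℝ) ^ k) :=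
        sum_le_sum fun m₁ hm₁ ↦ sum_le_sum fun m₂ hm₂ ↦ hterm m₁ hm₁ m₂ hm₂
    _ = B ^ 2 * ((((Mf / d₁ : ℕ) : ℝ)) ^ (k + 1) * ((Mf / d₂ : ℕ) : ℝ) ^ (k + 1)) := by
        simp only [sum_const, nsmul_eq_mul, Nat.card_Icc, Nat.add_sub_cancel]
        ring
    _ ≤ B ^ 2 * (((Mf : ℝ) / d₁) ^ (k + 1) * ((Mf : ℝ) / d₂) ^ (k + 1)) := by
        gcongr
    _ = B ^ 2 * (((Mf : ℝ)) ^ 2 / ((d₁ : ℝ) * d₂)) ^ (k + 1) := by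
        rw [← mul_pow]
        congr 2
        field_simp

/-- `⌈t⌉ ≤ 2t` for `t ≥ 1`. [folklore] -/
theorem natCeil_le_two_mul {t : ℝ} (ht : 1 ≤ t) : ((⌈t⌉₊ : ℕ) : ℝ) ≤ 2 * t := by
  have h := Nat.ceil_lt_add_one (by linarith : (0 : ℝ) ≤ t)
  linarith

/-- For `n₁ ≥ 1`: `#{n₂ ∈ [1, N] : d₁n₁·d₂n₂ ≤ Y} ≤ Y/(d₁d₂n₁)` (`d₁, d₂ ≥ 1`). [folklore] -/
theorem card_filter_hyperbola_le {d₁ d₂ n₁ : ℕ} (hd₁ : 1 ≤ d₁) (hd₂ : 1 ≤ d₂) (hn₁ : 1 ≤ n₁) (N Y : ℕ) :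
    ((#((Icc 1 N).filter (fun n₂ ↦ d₁ * n₁ * (d₂ * n₂) ≤ Y)) : ℕ) : ℝ) ≤ (Y : ℝ) / ((d₁ : ℝ) * d₂ * n₁) := by
  have hD : 0 < d₁ * n₁ * d₂ := by positivity
  have hsub : (Icc 1 N).filter (fun n₂ ↦ d₁ * n₁ * (d₂ * n₂) ≤ Y) ⊆ Icc 1 (Y / (d₁ * n₁ * d₂)) := by
    intro n₂ hn₂
    simp only [mem_filter, mem_Icc] at hn₂ ⊢
    refine ⟨hn₂.1.1, ?_⟩
    rw [Nat.le_div_iff_mul_le hD]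
    have : d₁ * n₁ * (d₂ * n₂) = n₂ * (d₁ * n₁ * d₂) := by ring
    rw [← this]; exact hn₂.2
  have hcard := card_le_card hsub
  rw [Nat.card_Icc, Nat.add_sub_cancel] at hcard
  have hD0 : (0 : ℝ) < (d₁ : ℝ) * d₂ * n₁ := by positivity
  calc ((#((Icc 1 N).filter (fun n₂ ↦ d₁ * n₁ * (d₂ * n₂) ≤ Y)) : ℕ) : ℝ) ≤ ((Y / (d₁ * n₁ * d₂) : ℕ) : ℝ) := by
        exact_mod_cast hcard
    _ ≤ (Y : ℝ) / ((d₁ * n₁ * d₂ : ℕ) : ℝ) := Nat.cast_div_le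
    _ = (Y : ℝ) / ((d₁ : ℝ) * d₂ * n₁) := by push_cast; ring

/-- `Σ_{n ≤ N} 1/n ≤ 1 + 2 log q` for `N ≤ q²` (`q ≥ 1`). [folklore] -/
theorem sum_Icc_inv_le_one_add_two_log {q N : ℕ} (hq : 1 ≤ q) (hN : N ≤ q ^ 2) :
    ∑ n ∈ Icc 1 N, ((n : ℝ))⁻¹ ≤ 1 + 2 * Real.log q := by
  have h := sum_Icc_inv_le_one_add_log 0 N
  rw [zero_add] at h
  refine h.trans ?_
  have hq0 : (0 : ℝ) < q := by exact_mod_cast hq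
  rcases Nat.eq_zero_or_pos N with rfl | hNpos
  · simp; positivity
  · have hN0 : (0 : ℝ) < N := by exact_mod_cast hNpos
    have hle : (N : ℝ) ≤ (q : ℝ) ^ 2 := by exact_mod_cast hN
    have := Real.log_le_log hN0 hle
    rw [Real.log_pow] at this
    push_cast at this
    linarith

/-- **AFE side**: `Σ_{n₁≤q²/d₁, n₂≤q²/d₂} |1_{d₁n₁d₂n₂≤Y}(d₁n₁d₂n₂)^{−1/2}W_{ij}(d₁n₁,d₂n₂)|(√n₁√n₂)^{2k+1}
≤ K L (1 + 2 log q) (Y/(d₁d₂))^{k+1}` (`‖(N₁N₂)^{−1/2}W‖√(N₁N₂) ≤ K L`, `n₁n₂ ≤ Y/(d₁d₂)` on the support, hyperbola count). [folklore] -/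
theorem sum_afe_side_le {q : ℕ} [NeZero q] (h64 : 64 ≤ q) {Δ' : ℝ} (i j : ℕ) {K : ℝ} (hK0 : 0 ≤ K)
    (hK : ∀ {N₁ N₂ : ℕ}, N₁ ∈ afeBox q → N₂ ∈ afeBox q →
      ‖((((N₁ : ℝ) * N₂) ^ (-(1 / 2 : ℝ)) : ℝ) : ℂ) * afeW (KMV2000.qhat q) i j N₁ N₂‖ *
          Real.sqrt ((N₁ : ℝ) * N₂) ≤
        K * ((1 + Real.log (KMV2000.qhat q)) * (1 + 2 * Real.log q)) ^ (i + j) *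
          (KMV2000.qhat q ^ 2 / ((N₁ : ℝ) * N₂)) ^ (0 : ℝ))
    (k Y : ℕ) {d₁ d₂ : ℕ} (hd₁ : d₁ ∈ Icc 1 ⌊KMV2000.qhat q ^ Δ'⌋₊) (hd₂ : d₂ ∈ Icc 1 ⌊KMV2000.qhat q ^ Δ'⌋₊) :
    ∑ n₁ ∈ Icc 1 (q ^ 2 / d₁), ∑ n₂ ∈ Icc 1 (q ^ 2 / d₂),
      ‖(if d₁ * n₁ * (d₂ * n₂) ≤ Y then
            ((((((d₁ * n₁ : ℕ) : ℝ) * ((d₂ * n₂ : ℕ) : ℝ)) ^ (-(1 / 2 : ℝ)) : ℝ) : ℂ) *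
              afeW (KMV2000.qhat q) i j (d₁ * n₁) (d₂ * n₂)) else 0) *
          ((Real.sqrt n₁ ^ (2 * k + 1) * Real.sqrt n₂ ^ (2 * k + 1) : ℝ) : ℂ)‖ ≤
      K * ((1 + Real.log (KMV2000.qhat q)) * (1 + 2 * Real.log q)) ^ (i + j) * (1 + 2 * Real.log q) *
        ((Y : ℝ) / ((d₁ : ℝ) * d₂)) ^ (k + 1) := by
  have hqh1 : 1 < KMV2000.qhat q := one_lt_qhat h64
  have hq1 : 1 ≤ q := le_trans (by norm_num) h64
  set L : ℝ := ((1 + Real.log (KMV2000.qhat q)) * (1 + 2 * Real.log q)) ^ (i + j) with hL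
  have hlq : 0 ≤ Real.log (q : ℝ) := Real.log_nonneg (by exact_mod_cast hq1)
  have hL0 : 0 ≤ L := by
    rw [hL]
    refine pow_nonneg (mul_nonneg ?_ ?_) _
    · linarith [Real.log_nonneg hqh1.le]
    · linarith
  have hd₁1 : 1 ≤ d₁ := (mem_Icc.mp hd₁).1
  have hd₂1 : 1 ≤ d₂ := (mem_Icc.mp hd₂).1
  have hd₁0 : (0 : ℝ) < d₁ := by exact_mod_cast hd₁1
  have hd₂0 : (0 : ℝ) < d₂ := by exact_mod_cast hd₂1
  set V : ℝ := (Y : ℝ) / ((d₁ : ℝ) * d₂) with hV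
  have hV0 : 0 ≤ V := by positivity
  -- termwise: `≤ K L V^k` on the support, `0` off it
  have hterm : ∀ n₁ ∈ Icc 1 (q ^ 2 / d₁), ∀ n₂ ∈ Icc 1 (q ^ 2 / d₂),
      ‖(if d₁ * n₁ * (d₂ * n₂) ≤ Y then
            ((((((d₁ * n₁ : ℕ) : ℝ) * ((d₂ * n₂ : ℕ) : ℝ)) ^ (-(1 / 2 : ℝ)) : ℝ) : ℂ) *
              afeW (KMV2000.qhat q) i j (d₁ * n₁) (d₂ * n₂)) else 0) *
          ((Real.sqrt n₁ ^ (2 * k + 1) * Real.sqrt n₂ ^ (2 * k + 1) : ℝ) : ℂ)‖ ≤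
        if d₁ * n₁ * (d₂ * n₂) ≤ Y then K * L * V ^ k else 0 := by
    intro n₁ hn₁ n₂ hn₂
    split_ifs with hc
    · have hn₁1 : 1 ≤ n₁ := (mem_Icc.mp hn₁).1
      have hn₂1 : 1 ≤ n₂ := (mem_Icc.mp hn₂).1
      have hN₁ : d₁ * n₁ ∈ afeBox q := by unfold afeBox; exact mul_mem_Icc_of_mem_div hd₁1 hn₁
      have hN₂ : d₂ * n₂ ∈ afeBox q := by unfold afeBox; exact mul_mem_Icc_of_mem_div hd₂1 hn₂
      have hw := hK hN₁ hN₂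
      rw [Real.rpow_zero, mul_one] at hw
      -- `n₁ n₂ ≤ V`
      have hnV : (n₁ : ℝ) * n₂ ≤ V := by
        rw [hV, le_div_iff₀ (by positivity)]
        have : d₁ * n₁ * (d₂ * n₂) = n₁ * n₂ * (d₁ * d₂) := by ring
        have h' : ((n₁ * n₂ * (d₁ * d₂) : ℕ) : ℝ) ≤ Y := by exact_mod_cast this ▸ hc
        push_cast at h'
        linarith
      -- `√n₁√n₂ ≤ √(N₁N₂)`
      have hXeq : ((d₁ * n₁ : ℕ) : ℝ) * ((d₂ * n₂ : ℕ) : ℝ) = ((d₁ : ℝ) * d₂) * ((n₁ : ℝ) * n₂) := by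
        push_cast; ring
      have hsqrt_le : Real.sqrt n₁ * Real.sqrt n₂ ≤ Real.sqrt (((d₁ * n₁ : ℕ) : ℝ) * ((d₂ * n₂ : ℕ) : ℝ)) := by
        rw [← Real.sqrt_mul (Nat.cast_nonneg n₁)]
        refine Real.sqrt_le_sqrt ?_
        rw [hXeq]
        have h1 : (1 : ℝ) ≤ (d₁ : ℝ) * d₂ := by
          have : (1 : ℝ) ≤ d₁ := by exact_mod_cast hd₁1
          have : (1 : ℝ) ≤ d₂ := by exact_mod_cast hd₂1
          nlinarith
        have hn0 : (0 : ℝ) ≤ (n₁ : ℝ) * n₂ := by positivity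
        nlinarith
      rw [norm_mul, Complex.norm_real, Real.norm_eq_abs,
        abs_of_nonneg (by positivity : (0 : ℝ) ≤ Real.sqrt n₁ ^ (2 * k + 1) * Real.sqrt n₂ ^ (2 * k + 1)),
        sqrt_pow_two_mul_add_one (Nat.cast_nonneg n₁), sqrt_pow_two_mul_add_one (Nat.cast_nonneg n₂)]
      set w : ℝ := ‖(((((d₁ * n₁ : ℕ) : ℝ) * ((d₂ * n₂ : ℕ) : ℝ)) ^ (-(1 / 2 : ℝ)) : ℝ) : ℂ) *
          afeW (KMV2000.qhat q) i j (d₁ * n₁) (d₂ * n₂)‖ with hw'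
      have hw0 : 0 ≤ w := norm_nonneg _
      calc w * ((n₁ : ℝ) ^ k * Real.sqrt n₁ * ((n₂ : ℝ) ^ k * Real.sqrt n₂))
          = (w * (Real.sqrt n₁ * Real.sqrt n₂)) * ((n₁ : ℝ) * n₂) ^ k := by ring
        _ ≤ (w * Real.sqrt (((d₁ * n₁ : ℕ) : ℝ) * ((d₂ * n₂ : ℕ) : ℝ))) * V ^ k :=
            mul_le_mul (mul_le_mul_of_nonneg_left hsqrt_le hw0) (pow_le_pow_left₀ (by positivity) hnV k)
              (by positivity) (by positivity)
        _ ≤ K * L * V ^ k := mul_le_mul_of_nonneg_right (by rw [hL]; exact hw) (by positivity)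
    · simp
  -- inner sum: the hyperbola count
  have hinner : ∀ n₁ ∈ Icc 1 (q ^ 2 / d₁),
      ∑ n₂ ∈ Icc 1 (q ^ 2 / d₂), (if d₁ * n₁ * (d₂ * n₂) ≤ Y then K * L * V ^ k else 0) ≤
        K * L * V ^ k * ((Y : ℝ) / ((d₁ : ℝ) * d₂ * n₁)) := by
    intro n₁ hn₁
    have hn₁1 : 1 ≤ n₁ := (mem_Icc.mp hn₁).1
    rw [← sum_filter, sum_const, nsmul_eq_mul, mul_comm]
    exact mul_le_mul_of_nonneg_left (card_filter_hyperbola_le hd₁1 hd₂1 hn₁1 _ Y) (by positivity)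
  calc _ ≤ ∑ n₁ ∈ Icc 1 (q ^ 2 / d₁), ∑ n₂ ∈ Icc 1 (q ^ 2 / d₂),
          (if d₁ * n₁ * (d₂ * n₂) ≤ Y then K * L * V ^ k else 0) :=
        sum_le_sum fun n₁ hn₁ ↦ sum_le_sum fun n₂ hn₂ ↦ hterm n₁ hn₁ n₂ hn₂
    _ ≤ ∑ n₁ ∈ Icc 1 (q ^ 2 / d₁), K * L * V ^ k * ((Y : ℝ) / ((d₁ : ℝ) * d₂ * n₁)) := sum_le_sum hinner
    _ = K * L * V ^ k * V * ∑ n₁ ∈ Icc 1 (q ^ 2 / d₁), ((n₁ : ℝ))⁻¹ := by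
        rw [mul_sum]
        refine sum_congr rfl fun n₁ _ ↦ ?_
        rw [hV]
        field_simp
    _ ≤ K * L * V ^ k * V * (1 + 2 * Real.log q) :=
        mul_le_mul_of_nonneg_left (sum_Icc_inv_le_one_add_two_log hq1 (Nat.div_le_self _ _)) (by positivity)
    _ = K * L * (1 + 2 * Real.log q) * V ^ (k + 1) := by ring

/-! ## §2. The trivial bound for one separated form and for the `(d₁, d₂)`-sum -/

/-- A four-fold sum of products factors. [folklore] -/
theorem sum_four_mul_eq (S₁ T₁ S₂ T₂ : Finset ℕ) (f g : ℕ → ℕ → ℝ) :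
    ∑ m₁ ∈ S₁, ∑ n₁ ∈ T₁, ∑ m₂ ∈ S₂, ∑ n₂ ∈ T₂, f m₁ m₂ * g n₁ n₂ =
      (∑ m₁ ∈ S₁, ∑ m₂ ∈ S₂, f m₁ m₂) * (∑ n₁ ∈ T₁, ∑ n₂ ∈ T₂, g n₁ n₂) := by
  rw [Finset.sum_mul_sum]
  refine sum_congr rfl fun m₁ _ ↦ sum_congr rfl fun n₁ _ ↦ ?_
  rw [Finset.sum_mul_sum]

/-- **The trivial bound for a separated form** (`|S(a,b;c)| ≤ c`):
`‖Σ A(m₁,m₂)B(n₁,n₂)S(m₁n₁,m₂n₂;c)‖ ≤ c · (Σ‖A‖) · (Σ‖B‖)`. [folklore] -/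
theorem norm_form_le_trivial (c : ℕ) [NeZero c] (S₁ T₁ S₂ T₂ : Finset ℕ) (A B : ℕ → ℕ → ℂ) :
    ‖∑ m₁ ∈ S₁, ∑ n₁ ∈ T₁, ∑ m₂ ∈ S₂, ∑ n₂ ∈ T₂,
        A m₁ m₂ * B n₁ n₂ * kloostermanSum c ((m₁ * n₁ : ℕ) : ZMod c) ((m₂ * n₂ : ℕ) : ZMod c)‖ ≤
      (c : ℝ) * (∑ m₁ ∈ S₁, ∑ m₂ ∈ S₂, ‖A m₁ m₂‖) * (∑ n₁ ∈ T₁, ∑ n₂ ∈ T₂, ‖B n₁ n₂‖) := by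
  have hS : ∀ a b : ℕ, ‖kloostermanSum c (a : ZMod c) (b : ZMod c)‖ ≤ c := fun a b ↦ by
    have h := norm_kloostermanSum_le (q := c) (a : ZMod c) (b : ZMod c)
    exact_mod_cast h
  calc _ ≤ ∑ m₁ ∈ S₁, ∑ n₁ ∈ T₁, ∑ m₂ ∈ S₂, ∑ n₂ ∈ T₂, ‖A m₁ m₂‖ * ‖B n₁ n₂‖ * (c : ℝ) := by
        refine (norm_sum_le _ _).trans (sum_le_sum fun m₁ _ ↦ (norm_sum_le _ _).trans
          (sum_le_sum fun n₁ _ ↦ (norm_sum_le _ _).trans (sum_le_sum fun m₂ _ ↦ (norm_sum_le _ _).trans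
          (sum_le_sum fun n₂ _ ↦ ?_))))
        rw [norm_mul, norm_mul]
        exact mul_le_mul_of_nonneg_left (hS _ _) (by positivity)
    _ = (c : ℝ) * ∑ m₁ ∈ S₁, ∑ n₁ ∈ T₁, ∑ m₂ ∈ S₂, ∑ n₂ ∈ T₂, ‖A m₁ m₂‖ * ‖B n₁ n₂‖ := by
        rw [mul_sum]
        refine sum_congr rfl fun _ _ ↦ ?_
        rw [mul_sum]
        refine sum_congr rfl fun _ _ ↦ ?_
        rw [mul_sum]
        refine sum_congr rfl fun _ _ ↦ ?_
        rw [mul_sum]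
        refine sum_congr rfl fun _ _ ↦ ?_
        ring
    _ = _ := by rw [sum_four_mul_eq, mul_assoc]

/-- **The trivial bound for the `(d₁,d₂)`-sum of the `k`-th separated forms** (`q ≥ 64`, `Δ' > 0`, `r ≥ 1`, any `Y`, `k`):
`Σ_{d₁,d₂ ≤ M} ‖Form_k(d₁,d₂;r)‖ ≤ 4 · qr · B²K L(1+2log q) · (M²Y)^{k+1}`. [folklore] -/
theorem sum_norm_form_le_trivial {q : ℕ} [NeZero q] (h64 : 64 ≤ q) {P : ℝ[X]} {B : ℝ}
    (hB : ∀ t ∈ Set.Icc (0 : ℝ) 1, |P.eval t| ≤ B) {Δ' : ℝ} (hΔ' : 0 < Δ') (i j : ℕ) {K : ℝ} (hK0 : 0 ≤ K)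
    (hK : ∀ {N₁ N₂ : ℕ}, N₁ ∈ afeBox q → N₂ ∈ afeBox q →
      ‖((((N₁ : ℝ) * N₂) ^ (-(1 / 2 : ℝ)) : ℝ) : ℂ) * afeW (KMV2000.qhat q) i j N₁ N₂‖ *
          Real.sqrt ((N₁ : ℝ) * N₂) ≤
        K * ((1 + Real.log (KMV2000.qhat q)) * (1 + 2 * Real.log q)) ^ (i + j) *
          (KMV2000.qhat q ^ 2 / ((N₁ : ℝ) * N₂)) ^ (0 : ℝ))
    {r : ℕ} [NeZero (q * r)] (k Y : ℕ) :
    ∑ d₁ ∈ Icc 1 ⌊KMV2000.qhat q ^ Δ'⌋₊, ∑ d₂ ∈ Icc 1 ⌊KMV2000.qhat q ^ Δ'⌋₊,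
      ‖∑ m₁ ∈ Icc 1 (⌊KMV2000.qhat q ^ Δ'⌋₊ / d₁), ∑ n₁ ∈ Icc 1 (q ^ 2 / d₁),
        ∑ m₂ ∈ Icc 1 (⌊KMV2000.qhat q ^ Δ'⌋₊ / d₂), ∑ n₂ ∈ Icc 1 (q ^ 2 / d₂),
          ((KMV2000.mollifierCoeff P (KMV2000.qhat q ^ Δ') (d₁ * m₁) : ℂ) *
              (KMV2000.mollifierCoeff P (KMV2000.qhat q ^ Δ') (d₂ * m₂) : ℂ) *
              ((Real.sqrt m₁ ^ (2 * k + 1) * Real.sqrt m₂ ^ (2 * k + 1) : ℝ) : ℂ)) *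
            ((if d₁ * n₁ * (d₂ * n₂) ≤ Y then
                ((((((d₁ * n₁ : ℕ) : ℝ) * ((d₂ * n₂ : ℕ) : ℝ)) ^ (-(1 / 2 : ℝ)) : ℝ) : ℂ) *
                  afeW (KMV2000.qhat q) i j (d₁ * n₁) (d₂ * n₂)) else 0) *
              ((Real.sqrt n₁ ^ (2 * k + 1) * Real.sqrt n₂ ^ (2 * k + 1) : ℝ) : ℂ)) *
            kloostermanSum (q * r) ((m₁ * n₁ : ℕ) : ZMod (q * r)) ((m₂ * n₂ : ℕ) : ZMod (q * r))‖ ≤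
      4 * ((q : ℝ) * r) * (B ^ 2 * K * ((1 + Real.log (KMV2000.qhat q)) * (1 + 2 * Real.log q)) ^ (i + j) *
        (1 + 2 * Real.log q)) *
        ((((⌊KMV2000.qhat q ^ Δ'⌋₊ : ℕ) : ℝ)) ^ 2 * (Y : ℝ)) ^ (k + 1) := by
  have hqh1 : 1 < KMV2000.qhat q := one_lt_qhat h64
  have hq1 : 1 ≤ q := le_trans (by norm_num) h64
  have hB0 : 0 ≤ B := le_trans (abs_nonneg _) (hB 0 (by simp))
  set Mf : ℕ := ⌊KMV2000.qhat q ^ Δ'⌋₊ with hMf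
  set L : ℝ := ((1 + Real.log (KMV2000.qhat q)) * (1 + 2 * Real.log q)) ^ (i + j) with hL
  have hlq : 0 ≤ Real.log (q : ℝ) := Real.log_nonneg (by exact_mod_cast hq1)
  have hL0 : 0 ≤ L := by
    rw [hL]
    refine pow_nonneg (mul_nonneg ?_ ?_) _
    · linarith [Real.log_nonneg hqh1.le]
    · linarith
  -- per block
  have hblk : ∀ d₁ ∈ Icc 1 Mf, ∀ d₂ ∈ Icc 1 Mf,
      ‖∑ m₁ ∈ Icc 1 (Mf / d₁), ∑ n₁ ∈ Icc 1 (q ^ 2 / d₁), ∑ m₂ ∈ Icc 1 (Mf / d₂), ∑ n₂ ∈ Icc 1 (q ^ 2 / d₂),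
          ((KMV2000.mollifierCoeff P (KMV2000.qhat q ^ Δ') (d₁ * m₁) : ℂ) *
              (KMV2000.mollifierCoeff P (KMV2000.qhat q ^ Δ') (d₂ * m₂) : ℂ) *
              ((Real.sqrt m₁ ^ (2 * k + 1) * Real.sqrt m₂ ^ (2 * k + 1) : ℝ) : ℂ)) *
            ((if d₁ * n₁ * (d₂ * n₂) ≤ Y then
                ((((((d₁ * n₁ : ℕ) : ℝ) * ((d₂ * n₂ : ℕ) : ℝ)) ^ (-(1 / 2 : ℝ)) : ℝ) : ℂ) *
                  afeW (KMV2000.qhat q) i j (d₁ * n₁) (d₂ * n₂)) else 0) *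
              ((Real.sqrt n₁ ^ (2 * k + 1) * Real.sqrt n₂ ^ (2 * k + 1) : ℝ) : ℂ)) *
            kloostermanSum (q * r) ((m₁ * n₁ : ℕ) : ZMod (q * r)) ((m₂ * n₂ : ℕ) : ZMod (q * r))‖ ≤
        ((q : ℝ) * r) * (B ^ 2 * K * L * (1 + 2 * Real.log q)) * (((Mf : ℝ)) ^ 2 * (Y : ℝ)) ^ (k + 1) *
          ((((d₁ : ℝ) * d₂) ^ 2)⁻¹) ^ (k + 1) := by
    intro d₁ hd₁ d₂ hd₂
    have hd₁0 : (0 : ℝ) < d₁ := by exact_mod_cast (mem_Icc.mp hd₁).1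
    have hd₂0 : (0 : ℝ) < d₂ := by exact_mod_cast (mem_Icc.mp hd₂).1
    have hA := sum_mollifier_side_le h64 hB hΔ' k hd₁ hd₂
    have hBs := sum_afe_side_le h64 (Δ' := Δ') i j hK0 hK k Y hd₁ hd₂
    have h := norm_form_le_trivial (q * r) (Icc 1 (Mf / d₁)) (Icc 1 (q ^ 2 / d₁)) (Icc 1 (Mf / d₂)) (Icc 1 (q ^ 2 / d₂))
      (fun m₁ m₂ ↦ (KMV2000.mollifierCoeff P (KMV2000.qhat q ^ Δ') (d₁ * m₁) : ℂ) *
          (KMV2000.mollifierCoeff P (KMV2000.qhat q ^ Δ') (d₂ * m₂) : ℂ) *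
          ((Real.sqrt m₁ ^ (2 * k + 1) * Real.sqrt m₂ ^ (2 * k + 1) : ℝ) : ℂ))
      (fun n₁ n₂ ↦ (if d₁ * n₁ * (d₂ * n₂) ≤ Y then
          ((((((d₁ * n₁ : ℕ) : ℝ) * ((d₂ * n₂ : ℕ) : ℝ)) ^ (-(1 / 2 : ℝ)) : ℝ) : ℂ) *
            afeW (KMV2000.qhat q) i j (d₁ * n₁) (d₂ * n₂)) else 0) *
          ((Real.sqrt n₁ ^ (2 * k + 1) * Real.sqrt n₂ ^ (2 * k + 1) : ℝ) : ℂ))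
    refine h.trans ?_
    have hc : ((q * r : ℕ) : ℝ) = (q : ℝ) * r := by push_cast; ring
    rw [hc]
    calc ((q : ℝ) * r) * _ * _ ≤ ((q : ℝ) * r) * (B ^ 2 * (((Mf : ℝ)) ^ 2 / ((d₁ : ℝ) * d₂)) ^ (k + 1)) *
          (K * L * (1 + 2 * Real.log q) * ((Y : ℝ) / ((d₁ : ℝ) * d₂)) ^ (k + 1)) :=
          mul_le_mul (mul_le_mul_of_nonneg_left hA (by positivity)) hBs
            (sum_nonneg fun _ _ ↦ sum_nonneg fun _ _ ↦ norm_nonneg _) (by positivity)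
      _ = _ := by
          rw [div_pow, div_pow, inv_pow]
          field_simp
          ring
  refine (sum_le_sum fun d₁ hd₁ ↦ sum_le_sum fun d₂ hd₂ ↦ hblk d₁ hd₁ d₂ hd₂).trans ?_
  -- `Σ_{d₁,d₂} ((d₁d₂)²)⁻¹)^{k+1} ≤ Σ (d₁²)⁻¹ (d₂²)⁻¹ ≤ 4`
  have hdd : ∀ d₁ ∈ Icc 1 Mf, ∀ d₂ ∈ Icc 1 Mf,
      (((((d₁ : ℝ) * d₂) ^ 2)⁻¹) ^ (k + 1) : ℝ) ≤ (((d₁ : ℝ)) ^ 2)⁻¹ * (((d₂ : ℝ)) ^ 2)⁻¹ := by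
    intro d₁ hd₁ d₂ hd₂
    have h₁ : (1 : ℝ) ≤ d₁ := by exact_mod_cast (mem_Icc.mp hd₁).1
    have h₂ : (1 : ℝ) ≤ d₂ := by exact_mod_cast (mem_Icc.mp hd₂).1
    have hge : (1 : ℝ) ≤ ((d₁ : ℝ) * d₂) ^ 2 := by
      have : (1 : ℝ) ≤ (d₁ : ℝ) * d₂ := by nlinarith
      nlinarith
    have hle1 : (((d₁ : ℝ) * d₂) ^ 2)⁻¹ ≤ 1 := inv_le_one_of_one_le₀ hge
    calc (((((d₁ : ℝ) * d₂) ^ 2)⁻¹) ^ (k + 1) : ℝ) = ((((d₁ : ℝ) * d₂) ^ 2)⁻¹) ^ k * (((d₁ : ℝ) * d₂) ^ 2)⁻¹ :=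
          pow_succ _ _
      _ ≤ 1 * (((d₁ : ℝ) * d₂) ^ 2)⁻¹ :=
          mul_le_mul_of_nonneg_right (pow_le_one₀ (by positivity) hle1) (by positivity)
      _ = (((d₁ : ℝ)) ^ 2)⁻¹ * (((d₂ : ℝ)) ^ 2)⁻¹ := by rw [one_mul, mul_pow, mul_inv]
  set C : ℝ := ((q : ℝ) * r) * (B ^ 2 * K * L * (1 + 2 * Real.log q)) * (((Mf : ℝ)) ^ 2 * (Y : ℝ)) ^ (k + 1)
    with hC
  have hC0 : 0 ≤ C := by rw [hC]; positivity
  calc ∑ d₁ ∈ Icc 1 Mf, ∑ d₂ ∈ Icc 1 Mf, C * (((((d₁ : ℝ) * d₂) ^ 2)⁻¹) ^ (k + 1))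
      ≤ ∑ d₁ ∈ Icc 1 Mf, ∑ d₂ ∈ Icc 1 Mf, C * ((((d₁ : ℝ)) ^ 2)⁻¹ * (((d₂ : ℝ)) ^ 2)⁻¹) :=
        sum_le_sum fun d₁ hd₁ ↦ sum_le_sum fun d₂ hd₂ ↦ mul_le_mul_of_nonneg_left (hdd d₁ hd₁ d₂ hd₂) hC0
    _ = C * ((∑ d₁ ∈ Icc 1 Mf, (((d₁ : ℝ)) ^ 2)⁻¹) * (∑ d₂ ∈ Icc 1 Mf, (((d₂ : ℝ)) ^ 2)⁻¹)) := by
        rw [Finset.sum_mul_sum, mul_sum]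
        refine sum_congr rfl fun _ _ ↦ ?_
        rw [mul_sum]
    _ ≤ C * (2 * 2) :=
        mul_le_mul_of_nonneg_left (mul_le_mul (sum_Icc_inv_sq_le_two Mf) (sum_Icc_inv_sq_le_two Mf)
          (sum_nonneg fun _ _ ↦ by positivity) (by norm_num)) hC0
    _ = _ := by rw [hC, hL]; ring

end Summit.Parity.GeneralizedHardyLittlewood.Theorems.MomentsBeyondDiagonal.Layers

end
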